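import Summits.Langlands.Langlands.Theses.OrdinaryPrimeTransport
import Summits.Langlands.Langlands.Theorems.BaseFieldAscentReciprocityTRCMPotentialAutomorphyCMTightness
import Literature.NumberTheory.Automorphic.Qian2022PotentialAutomorphy
import Literature.NumberTheory.Automorphic.ACCAutomorphyLiftingCrystalline
import Literature.NumberTheory.GaloisRepresentations.CrystallineOrdinary
import Literature.NumberTheory.GaloisRepresentations.LabelledHodgeTateWeights
import Literature.NumberTheory.GaloisRepresentations.CrystallineDeformationRing
import Literature.NumberTheory.GaloisRepresentations.RestrictFieldSelf
import HarnessLib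

/-!
# SKELETON — line `FontaineLaffaillePotentialAutomorphyCM` for the crux `ReciprocityUpToIrreducibility`
# (item stmt-Langlands-14328; routes IrreducibilityBySelfDuality / OrdinaryPrimeTransport)
# forward generator G4 ladder-down, generation 30 (unit fwd2-ladder-Langlands-14328-g30)

PUBLICATION NOTE.  The crux item stmt-Langlands-14328 is ONE statement carried verbatim by both route files
(`Iff.rfl`-equal decls `Summit.Langlands.Langlands.Theses.IrreducibilityBySelfDuality.ReciprocityUpToIrreducibility`,
primary, and `Summit.Langlands.Langlands.Theses.OrdinaryPrimeTransport.ReciprocityUpToIrreducibility`).  As for the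
lines g25–g29 this file imports `Theses.OrdinaryPrimeTransport` only and concludes the OPT decl BY NAME (the
crux-workfile farm lane answers "remote:incoherent … Theses.IrreducibilityBySelfDuality: mismatch" for the primary
module); the two decls are interchangeable by `Iff.rfl`.

DIAL θ32 = the `p`-ADIC HODGE TYPE AT `v ∣ ℓ` in SINGLE-REPRESENTATION POTENTIAL AUTOMORPHY OVER CM FIELDS WITHOUT
SELF-DUALITY (clause (B) of the top read "potentially" and with the residual-automorphy seed REMOVED): for `K`
(imaginary) CM, `n ≥ 2`, `r : Γ_K → GL_n(ℚ̄_ℓ)` irreducible, unramified almost everywhere, with residual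
representation `r̄` absolutely irreducible and decomposed generic, `r̄(Γ_{K(ζ_ℓ)})` absolutely irreducible and
enormous, and a scalar `r̄(σ)` for some `σ ∉ Γ_{K(ζ_ℓ)}` (the residual hypotheses of Qian 2023 Thm. 1.4 = ACC+
Thm. 6.1.1/6.1.2, verbatim as in the tree's `Qian2022.potentialAutomorphy_ordinary` /
`ACCGHLNSTT2023.automorphyLifting_crystalline_weightZero`), and a LOCAL CLAUSE at every `v ∣ ℓ` graded by θ:

* θ = 0 : de Rham (pinned Fontaine datum) and CRYSTALLINE-ORDINARY with distinct cyclotomic exponents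
          (`FramedGaloisRep.IsCrystallineOrdinaryAt ℓ v`)                         — FLOOR, Qian 2023 Thm. 1.4;
* θ = 1 : θ = 0, or `ℓ` unramified in `K` and `r|_{Γ_{K_v}}` crystalline for the pinned datum with labelled
          Hodge–Tate weights `{0, 1, …, n-1}` at every label                   — the CONSECUTIVE-WEIGHT cell,
          = the target `WeightZeroNonOrdinaryPA` of route `StickelbergerDial` (stmt-Langlands-18031, open);
* θ = 2 : θ = 0, or `ℓ` unramified in `K` and `r|_{Γ_{K_v}}` crystalline for the pinned datum with labelled
          Hodge–Tate weights pairwise distinct and of spread `≤ ℓ - 2` at every label (Fontaine–Laffaille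
          range, ARBITRARY regular weight)                                       — THE RUNG (this line);
* θ = 3 : de Rham for the pinned datum with pairwise distinct labelled Hodge–Tate weights (any `ℓ`, any
          ramification of `ℓ` in `K`, any Hodge type)                           — the regular sector of (B).

Conclusion of every cell (POTENTIAL weak automorphy): a number field `K' ⊇ K`, Galois over `K` and CM, and an
L-algebraic cuspidal `π'` of `GL_n(𝔸_{K'})` Satake–Frobenius compatible (summit clause `SatakeFrobCompatibleAt`,
L-normalisation) with `r|_{Γ_{K'}}` at all but finitely many places of `K'`.  The local clauses are cumulative
disjunctions, so `family_mono : PotAutCM (θ+1) → PotAutCM θ` is bookkeeping; the summit gives every cell with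
`K' := K` (`potAutCMOn_of_langlands`, F4), and the floor text (Qian 2023 Thm. 1.4, crystalline-ordinary case,
conclusion read for the L-algebraic twist `π ⊗ |det|^{(1-n)/2}` of Qian's regular algebraic `π`) gives θ = 0
(`floor_qian`, F3).

LOCATED STOP of the θ = 0 proof (Qian: Dwork-family residual potential automorphy Thm. 1.1 + ordinary
automorphy lifting ACC+ Thm. 6.1.2 with Hida-theoretic change of weight): (i) the motivic witnesses (Dwork /
Fermat hypersurface pieces) have CONSECUTIVE labelled Hodge–Tate weights by Griffiths transversality
(`Literature.Barriers.Langlands.FamilyWitnessConsecutiveWeights`), so residual automorphy is produced in weight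
`0` only; (ii) passing from weight `0` to the weight of `r` needs a change-of-weight automorphy lifting theorem,
available WITHOUT conjugate self-duality only in the ordinary case (Hida families inside ACC+ Thm. 6.1.2) — the
Fontaine–Laffaille lifting theorem ACC+ Thm. 6.1.1 is fixed-weight and needs `ℓ` unramified in the field and the
seed `π` unramified above `ℓ` of the SAME weight, while for non-consecutive Fontaine–Laffaille weights the
reduction `r̄|_{I_v}` (tame inertia weights = the Hodge–Tate weights, Fontaine–Laffaille) is not the reduction of
a weight-`0` crystalline representation over an extension unramified at `v`; (iii) the potentially-diagonalizable
change of weight of BLGGT (Thm. 4.3.1 / "Harris tensor-product trick") and its non-polarizable extension by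
Matsumoto (arXiv:2312.01551, Thm. 5.25: reaches `r_ι(π) ⊗ r|_{F'}` only, under a parity condition and weight gaps
`≥ n`) do not give potential automorphy of a non-self-dual `r` of general regular weight — Matsumoto p. 8: "the
potential automorphy theorem for non-self dual representation is only known in the following cases: 1. ρ̄_λ = Symⁿ r̄_λ
… 2. … ρ_λ … ordinary [Qia23]"; problem (*) ibid.  The consecutive-weight cell θ = 1 is where (ii) does not
bite (same weight as the witness) and is filed as route `StickelbergerDial`; the rung θ = 2 is the first cell
needing a genuinely new change-of-weight input.

Structure: §1 clauses and family; §2 monotonicity; §3 floor (F3); §4 on-path (F4); §5 sector / merge target /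
off-sector complement; §6 the four registered stubs; §7 the composition `ReciprocityUpToIrreducibility_of :
Rung → HigherRungs → SectorMergeStep → OffSectorReciprocity → E` (no sorry outside `stub_*`).

Disproof used (`Cruxes/ReciprocityUpToIrreducibility/Disproof.lean` §B, pinned-datum normalisation:
`wdTrivialClause_of_reciprocityUpToIrreducibility`, `exists_isFontaineDatum_not_wdTrivialClause`): every local
clause below is predicated of THE pinned datum `fontainePstAdicCompletion v ℓ hv` (= `Rec.pst ℓ v hv` by `rfl`),
never of a prover-chosen `PstWeilDeligneData`, and no reciprocity datum enters the family — so the recorded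
misstatement of stmt-Langlands-1060/14091 (permissive `R.pst`) cannot recur.
-/

noncomputable section

set_option linter.dupNamespace false

open scoped MatrixGroups Matrix NumberField Classical TensorProduct
open Filter IsDedekindDomain Field
open Literature.NumberTheory.Automorphic Literature.NumberTheory.GaloisRepresentations
open Literature.NumberTheory.PAdicHodge
open Summit.Langlands

namespace Summit.Langlands.Langlands.Cruxes.ReciprocityUpToIrreducibility.FontaineLaffaillePotentialAutomorphyCM

/-! ## 1. The graded local clause and the family -/

section Clauses

variable (K : Type) [Field K] [NumberField K] (ℓ : ℕ) [Fact ℓ.Prime] {n : ℕ}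
  (r : FramedGaloisRep K (PadicAlgCl ℓ) n) (v : HeightOneSpectrum (𝓞 K)) (hv : ((ℓ : ℕ) : 𝓞 K) ∈ v.asIdeal)

/-- Cell θ = 0 at `v ∣ ℓ` (FLOOR, Qian 2023 Thm. 1.4 / Def. 1.2 in the crystalline-ordinary case): de Rham for
the pinned Fontaine datum and crystalline-ordinary with strictly decreasing cyclotomic exponents. -/
def OrdClause : Prop :=
  (fontainePstAdicCompletion v ℓ hv).IsDeRhamFramed (r.toLocal v) ∧ r.IsCrystallineOrdinaryAt ℓ v

/-- Cell θ = 1 at `v ∣ ℓ` (the consecutive-weight Fontaine–Laffaille cell of route `StickelbergerDial`,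
`WeightZeroNonOrdinaryPA`): `ℓ` unramified in `K`, `r|_{Γ_{K_v}}` crystalline for the pinned datum, labelled
Hodge–Tate weights `{0, …, n-1}` at every `ℚ_ℓ`-label. -/
def FLConsecutiveClause : Prop :=
  Algebra.IsUnramifiedIn (𝓞 K) (Ideal.span {(ℓ : ℤ)}) ∧
    (let D := fontainePstAdicCompletion v ℓ hv
     D.IsCrystallineFramed (r.toLocal v) ∧
       (letI := D.algebra
        ∀ τ' : v.adicCompletion K →ₐ[ℚ_[ℓ]] PadicAlgCl ℓ,
          r.labelledHodgeTateWeightsAt v D.algebra D.𝔅 τ'.toRingHom = (Multiset.range n).map fun i : ℕ => (i : ℤ)))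

/-- Cell θ = 2 at `v ∣ ℓ` (THE RUNG's clause, Fontaine–Laffaille of ARBITRARY regular weight): `ℓ` unramified
in `K`, `r|_{Γ_{K_v}}` crystalline for the pinned datum, labelled Hodge–Tate weights pairwise distinct and of
spread `≤ ℓ - 2` at every `ℚ_ℓ`-label. -/
def FLClause : Prop :=
  Algebra.IsUnramifiedIn (𝓞 K) (Ideal.span {(ℓ : ℤ)}) ∧
    (let D := fontainePstAdicCompletion v ℓ hv
     D.IsCrystallineFramed (r.toLocal v) ∧
       (letI := D.algebra
        ∀ τ' : v.adicCompletion K →ₐ[ℚ_[ℓ]] PadicAlgCl ℓ,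
          (r.labelledHodgeTateWeightsAt v D.algebra D.𝔅 τ'.toRingHom).Nodup ∧
            ∀ a ∈ r.labelledHodgeTateWeightsAt v D.algebra D.𝔅 τ'.toRingHom,
              ∀ b ∈ r.labelledHodgeTateWeightsAt v D.algebra D.𝔅 τ'.toRingHom, a - b ≤ (ℓ : ℤ) - 2))

/-- Cell θ = 3 at `v ∣ ℓ` (the whole regular sector): de Rham for the pinned datum with pairwise distinct
labelled Hodge–Tate weights at every `ℚ_ℓ`-label. -/
def RegularClause : Prop :=
  let D := fontainePstAdicCompletion v ℓ hv
  D.IsDeRhamFramed (r.toLocal v) ∧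
    (letI := D.algebra
     ∀ τ' : v.adicCompletion K →ₐ[ℚ_[ℓ]] PadicAlgCl ℓ,
       (r.labelledHodgeTateWeightsAt v D.algebra D.𝔅 τ'.toRingHom).Nodup)

/-- **The graded local clause** (cumulative disjunction, so monotone in θ by construction). -/
def LocalClause (θ : ℕ) : Prop :=
  OrdClause K ℓ r v hv ∨ (1 ≤ θ ∧ FLConsecutiveClause K ℓ r v hv) ∨ (2 ≤ θ ∧ FLClause K ℓ r v hv) ∨
    (3 ≤ θ ∧ RegularClause K ℓ r v hv)

variable {K ℓ r v hv}

theorem localClause_mono {θ θ' : ℕ} (hθ : θ ≤ θ') (h : LocalClause K ℓ r v hv θ) :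
    LocalClause K ℓ r v hv θ' := by
  rcases h with h | ⟨h1, h⟩ | ⟨h2, h⟩ | ⟨h3, h⟩
  · exact Or.inl h
  · exact Or.inr (Or.inl ⟨h1.trans hθ, h⟩)
  · exact Or.inr (Or.inr (Or.inl ⟨h2.trans hθ, h⟩))
  · exact Or.inr (Or.inr (Or.inr ⟨h3.trans hθ, h⟩))

/-- Every cell is de Rham for the pinned datum (crystalline ⇒ de Rham, `IsCrystallineFramed.isDeRhamFramed`). -/
theorem isDeRhamFramed_of_localClause {θ : ℕ} (h : LocalClause K ℓ r v hv θ) :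
    (fontainePstAdicCompletion v ℓ hv).IsDeRhamFramed (r.toLocal v) := by
  rcases h with h | ⟨-, h⟩ | ⟨-, h⟩ | ⟨-, h⟩
  · exact h.1
  · exact h.2.1.isDeRhamFramed
  · exact h.2.1.isDeRhamFramed
  · exact h.1

end Clauses

/-- The residual hypotheses of Qian 2023 Thm. 1.4 = ACC+ Thm. 6.1.1 (3)–(4), on a residual representation
`τ` of `r` (`𝔽̄_ℓ`-coefficients): absolutely irreducible, decomposed generic, `τ|_{Γ_{K(ζ_ℓ)}}` absolutely
irreducible with enormous image, and a scalar `τ σ` for some `σ ∉ Γ_{K(ζ_ℓ)}`. -/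
def ResidualHyp (K : Type) [Field K] [NumberField K] (ℓ : ℕ) [Fact ℓ.Prime] {n : ℕ}
    (r : FramedGaloisRep K (PadicAlgCl ℓ) n)
    (τ : absoluteGaloisGroup K →* GL (Fin n) (padicAlgClResidueField ℓ)) : Prop :=
  r.IsResidualRepOf (RingHom.id _) τ ∧ IsAbsIrreducible τ ∧ IsDecomposedGeneric τ ∧
    IsAbsIrreducible (τ.comp (absGaloisGroupAdjoinRootsOfUnity K ℓ).subtype) ∧
    Subgroup.IsEnormous ((absGaloisGroupAdjoinRootsOfUnity K ℓ).map τ) ∧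
    ∃ σ : absoluteGaloisGroup K, σ ∉ absGaloisGroupAdjoinRootsOfUnity K ℓ ∧
      ∃ c : padicAlgClResidueField ℓ, (τ σ).1 = c • 1

/-- **Potential weak automorphy over a CM Galois extension** (the common conclusion of every cell): a number
field `K' ⊇ K`, Galois over `K` and CM, and an L-algebraic cuspidal `π'` of `GL_n(𝔸_{K'})` Satake–Frobenius
compatible with `r|_{Γ_{K'}}` at all but finitely many places. -/
def PotentiallyWeaklyAutomorphicCM (K : Type) [Field K] [NumberField K] (ℓ : ℕ) [Fact ℓ.Prime] {n : ℕ}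
    (ι : PadicAlgCl ℓ ≃+* ℂ) (r : FramedGaloisRep K (PadicAlgCl ℓ) n) : Prop :=
  ∃ (K' : Type) (_ : Field K') (_ : NumberField K') (_ : Algebra K K') (_ : IsGalois K K'),
    NumberField.IsCMField K' ∧
      ∃ (hcpt' : isCompact_glFiniteIntegralLevel n K') (π' : CuspidalAutomorphicRepData n K' hcpt'),
        π'.1.IsLAlgebraic ∧
          ∀ᶠ w : HeightOneSpectrum (𝓞 K') in cofinite, SatakeFrobCompatibleAt ι π'.1 (r.restrictField K') w

/-- The family over an arbitrary hypothesis `H` on `(K, ℓ, r)` (used for the cells and their complements). -/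
def PotAutCMOn
    (H : ∀ (K : Type) [Field K] [NumberField K] (ℓ : ℕ) [Fact ℓ.Prime] (n : ℕ),
      FramedGaloisRep K (PadicAlgCl ℓ) n → Prop) : Prop :=
  ∀ (K : Type) [Field K] [NumberField K], NumberField.IsCMField K →
    ∀ (n : ℕ), 2 ≤ n →
    ∀ (ℓ : ℕ) [Fact ℓ.Prime] (ι : PadicAlgCl ℓ ≃+* ℂ) (r : FramedGaloisRep K (PadicAlgCl ℓ) n)
      (τ : absoluteGaloisGroup K →* GL (Fin n) (padicAlgClResidueField ℓ)),
      r.toGaloisRep.IsIrreducible →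
      (∀ᶠ v : HeightOneSpectrum (𝓞 K) in cofinite, r.IsUnramifiedAt v) →
      H K ℓ n r → ResidualHyp K ℓ r τ → PotentiallyWeaklyAutomorphicCM K ℓ ι r

/-- The hypothesis of cell θ: the graded local clause at EVERY `v ∣ ℓ`. -/
def CellHyp (θ : ℕ) (K : Type) [Field K] [NumberField K] (ℓ : ℕ) [Fact ℓ.Prime] (n : ℕ)
    (r : FramedGaloisRep K (PadicAlgCl ℓ) n) : Prop :=
  ∀ (v : HeightOneSpectrum (𝓞 K)) (hv : ((ℓ : ℕ) : 𝓞 K) ∈ v.asIdeal), LocalClause K ℓ r v hv θ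

/-- **THE FAMILY** `PotAutCM θ`: single-representation potential weak automorphy over CM fields for irreducible
`r` with big residual image whose local type at every `v ∣ ℓ` lies in cell θ. -/
def PotAutCM (θ : ℕ) : Prop :=
  PotAutCMOn (CellHyp θ)

/-- **THE RUNG (crux #1 of the ladder)**: `PotAutCM 2` — Fontaine–Laffaille crystalline of ARBITRARY regular
weight (or crystalline-ordinary) at every `v ∣ ℓ`, `ℓ` unramified in the CM field `K`, no self-duality. -/
def FontaineLaffaillePotentialAutomorphyCM : Prop :=
  PotAutCM 2

/-! ## 2. Monotonicity (bookkeeping) -/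

theorem cellHyp_mono {θ θ' : ℕ} (hθ : θ ≤ θ') {K : Type} [Field K] [NumberField K] {ℓ : ℕ} [Fact ℓ.Prime]
    {n : ℕ} {r : FramedGaloisRep K (PadicAlgCl ℓ) n} (h : CellHyp θ K ℓ n r) : CellHyp θ' K ℓ n r :=
  fun v hv => localClause_mono hθ (h v hv)

theorem potAutCMOn_mono
    {H H' : ∀ (K : Type) [Field K] [NumberField K] (ℓ : ℕ) [Fact ℓ.Prime] (n : ℕ),
      FramedGaloisRep K (PadicAlgCl ℓ) n → Prop}
    (hHH' : ∀ (K : Type) [Field K] [NumberField K] (ℓ : ℕ) [Fact ℓ.Prime] (n : ℕ)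
      (r : FramedGaloisRep K (PadicAlgCl ℓ) n), H K ℓ n r → H' K ℓ n r)
    (h : PotAutCMOn H') : PotAutCMOn H :=
  fun K _ _ hK n hn ℓ _ ι r τ hirr hur hH hres => h K hK n hn ℓ ι r τ hirr hur (hHH' K ℓ n r hH) hres

/-- **Dial monotonicity** (a larger θ is a stronger statement). -/
theorem family_mono {θ θ' : ℕ} (hθ : θ ≤ θ') (h : PotAutCM θ') : PotAutCM θ :=
  potAutCMOn_mono (fun _ _ _ _ _ _ _ hH => cellHyp_mono hθ hH) h

@[aesop safe apply]
theorem floorFamily_of_rung (h : FontaineLaffaillePotentialAutomorphyCM) : PotAutCM 0 :=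
  family_mono (Nat.zero_le 2) h

theorem consecutiveCell_of_rung (h : FontaineLaffaillePotentialAutomorphyCM) : PotAutCM 1 :=
  family_mono one_le_two h

/-! ## 3. The floor (F3): Qian 2023 Thm. 1.4, crystalline-ordinary case -/

/-- **Qian 2023, Theorem 1.4 — crystalline-ordinary case, a.e.-Satake conclusion** (NAMED TEXT FACT, the floor
of the ladder).  L. Qian, *Potential automorphy for `GL_n`*, Invent. Math. 231 (2023) 1239–1275 (arXiv:2104.09761),
Thm. 1.4 (p. 2) with Def. 1.2–1.3, read in the tree's vocabulary exactly as the accepted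
`Literature.NumberTheory.Automorphic.Qian2022.potentialAutomorphy_ordinary` EXCEPT: (a) hypothesis (ii)
"potentially semistable, ordinary with regular Hodge–Tate weights at `v ∣ l`" is SPECIALISED to "de Rham for the
pinned Fontaine datum and crystalline-ordinary with strictly decreasing cyclotomic exponents"
(`IsCrystallineOrdinaryAt`: a full `Γ_{K_v}`-stable flag with graded pieces `ψ_i ε^{b_i}`, `ψ_i` UNRAMIFIED,
`b` strictly decreasing — the case of Def. 1.2 in which the characters `χ_i ∘ Art_{K_v}|_{𝒪^×}` are the algebraic
characters `∏_τ τ^{-μ_{τ,i}}` on all of `𝒪_{K_v}^×` with `μ_τ` strictly monotone, i.e. no finite-order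
ramified twist; at the genuine Artin map `ε ∘ Art|_{𝒪^×} = N^{-1}`), and an irreducibility hypothesis on `r`
is ADDED (implied anyway by absolute irreducibility of `r̄`); (b) the avoidance field is dropped (`K^{av} := K`)
and the conclusion "`r|_{Γ_{K'}} ≅ r_{l,ι}(π)`, `π` regular algebraic cuspidal of `GL_n(𝔸_{K'})`" is read for the
L-algebraic cuspidal twist `π' := π ⊗ |det|^{(1-n)/2}` (Clozel 1990 §3.5; Buzzard–Gee 2014 §5: `r_{l,ι}(π)` is
unramified at almost all `w` with `char r_{l,ι}(π)(Frob_w)` the Satake polynomial of `π'_w` in the L-normalisation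
of the summit clause `SatakeFrobCompatibleAt`).  Both changes make the text WEAKER than the printed theorem.
[cite: Qian2022, Thm. 1.4 (p. 2), Def. 1.2, Def. 1.3] [cite: ACCGHLNSTT2023, Thm. 6.1.2, Def. 4.3.1, Def. 6.2.28]
[cite: BuzzardGeeLMS2014, §5 and Conj. 3.2.1] -/
def Qian2023OrdinaryPotentialAutomorphyText : Prop :=
  ∀ (K : Type) [Field K] [NumberField K], NumberField.IsCMField K →
    ∀ (n : ℕ), 2 ≤ n →
    ∀ (ℓ : ℕ) [Fact ℓ.Prime] (ι : PadicAlgCl ℓ ≃+* ℂ) (r : FramedGaloisRep K (PadicAlgCl ℓ) n),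
      r.toGaloisRep.IsIrreducible →
      (∀ᶠ v : HeightOneSpectrum (𝓞 K) in cofinite, r.IsUnramifiedAt v) →
      (∀ (v : HeightOneSpectrum (𝓞 K)) (hv : ((ℓ : ℕ) : 𝓞 K) ∈ v.asIdeal),
        (fontainePstAdicCompletion v ℓ hv).IsDeRhamFramed (r.toLocal v) ∧ r.IsCrystallineOrdinaryAt ℓ v) →
      (∃ τ : absoluteGaloisGroup K →* GL (Fin n) (padicAlgClResidueField ℓ),
        r.IsResidualRepOf (RingHom.id _) τ ∧ IsAbsIrreducible τ ∧ IsDecomposedGeneric τ ∧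
          IsAbsIrreducible (τ.comp (absGaloisGroupAdjoinRootsOfUnity K ℓ).subtype) ∧
          Subgroup.IsEnormous ((absGaloisGroupAdjoinRootsOfUnity K ℓ).map τ) ∧
          ∃ σ : absoluteGaloisGroup K, σ ∉ absGaloisGroupAdjoinRootsOfUnity K ℓ ∧
            ∃ c : padicAlgClResidueField ℓ, (τ σ).1 = c • 1) →
      ∃ (K' : Type) (_ : Field K') (_ : NumberField K') (_ : Algebra K K') (_ : IsGalois K K'),
        NumberField.IsCMField K' ∧
          ∃ (hcpt' : isCompact_glFiniteIntegralLevel n K') (π' : CuspidalAutomorphicRepData n K' hcpt'),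
            π'.1.IsLAlgebraic ∧
              ∀ᶠ w : HeightOneSpectrum (𝓞 K') in cofinite, SatakeFrobCompatibleAt ι π'.1 (r.restrictField K') w

/-- **F3 bridge**: the floor text gives cell θ = 0. -/
theorem floor_qian (h : Qian2023OrdinaryPotentialAutomorphyText) : PotAutCM 0 := by
  intro K _ _ hK n hn ℓ _ ι r τ hirr hur hcell hres
  refine h K hK n hn ℓ ι r hirr hur (fun v hv => ?_) ⟨τ, hres⟩
  rcases hcell v hv with h0 | ⟨h1, -⟩ | ⟨h2, -⟩ | ⟨h3, -⟩
  · exact h0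
  · exact absurd h1 (by norm_num)
  · exact absurd h2 (by norm_num)
  · exact absurd h3 (by norm_num)

/-- **F3 WITNESS**: the family specialises to the proved floor at θ = 0. -/
example (h : Qian2023OrdinaryPotentialAutomorphyText) : PotAutCM 0 :=
  floor_qian h

/-! ## 4. On-path (F4): the summit, and the top E, give every cell with `K' := K` -/

/-- Weak automorphy over `K` itself is potential weak automorphy over the CM Galois extension `K' := K`
(`Algebra.id`, `IsGalois.self`; `r|_{Γ_K}` along `K ≤ K` is a change of frame, landed
`ReciprocityTRCM.satakeFrobCompatibleAt_restrictField_self`). [folklore] -/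
theorem potentiallyWeaklyAutomorphicCM_self {K : Type} [Field K] [NumberField K] (hK : NumberField.IsCMField K)
    {ℓ : ℕ} [Fact ℓ.Prime] {n : ℕ} (ι : PadicAlgCl ℓ ≃+* ℂ) (r : FramedGaloisRep K (PadicAlgCl ℓ) n)
    {hcpt : isCompact_glFiniteIntegralLevel n K} (π : CuspidalAutomorphicRepData n K hcpt)
    (hL : π.1.IsLAlgebraic)
    (hsat : ∀ᶠ v : HeightOneSpectrum (𝓞 K) in cofinite, SatakeFrobCompatibleAt ι π.1 r v) :
    PotentiallyWeaklyAutomorphicCM K ℓ ι r :=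
  ⟨K, inferInstance, inferInstance, inferInstance, IsGalois.self K, hK, hcpt, π, hL,
    hsat.mono fun _ hv => Theorems.ReciprocityTRCM.satakeFrobCompatibleAt_restrictField_self ι π.1 hv⟩

/-- Clause (B) (Galois → automorphic) over the CM field `K` for ONE reciprocity datum gives the family's
conclusion for every `r` in any cell (each cell is de Rham for the pinned datum = `Rec.pst` by `rfl`). -/
theorem potAutCMOn_of_galoisToAutomorphic
    (H : ∀ (K : Type) [Field K] [NumberField K] (ℓ : ℕ) [Fact ℓ.Prime] (n : ℕ),
      FramedGaloisRep K (PadicAlgCl ℓ) n → Prop)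
    (hdR : ∀ (K : Type) [Field K] [NumberField K] (ℓ : ℕ) [Fact ℓ.Prime] (n : ℕ)
      (r : FramedGaloisRep K (PadicAlgCl ℓ) n), H K ℓ n r →
        ∀ (v : HeightOneSpectrum (𝓞 K)) (hv : ((ℓ : ℕ) : 𝓞 K) ∈ v.asIdeal),
          (fontainePstAdicCompletion v ℓ hv).IsDeRhamFramed (r.toLocal v))
    (hB : ∀ (K : Type) [Field K] [NumberField K], NumberField.IsCMField K →
      ∃ Rec : ReciprocityData K, ∀ n : ℕ, 0 < n →
        ∀ hcpt : isCompact_glFiniteIntegralLevel n K, GaloisToAutomorphic n Rec hcpt) :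
    PotAutCMOn H := by
  intro K _ _ hK n hn ℓ _ ι r τ hirr hur hH _hres
  obtain ⟨Rec, hall⟩ := hB K hK
  have hgeo : IsGeometricFramed Rec r := ⟨hur, fun v hv => hdR K ℓ n r hH v hv⟩
  obtain ⟨π, hLalg, hcorr⟩ :=
    hall n (by omega) (isCompact_glFiniteIntegralLevel_holds n K) ℓ ι r hirr hgeo
  exact potentiallyWeaklyAutomorphicCM_self hK ι r π hLalg hcorr.1

/-- `Langlands → PotAutCM θ` for every θ. -/
theorem potAutCM_of_langlands (θ : ℕ) (hL : _root_.Langlands) : PotAutCM θ :=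
  potAutCMOn_of_galoisToAutomorphic _ (fun _ _ _ _ _ _ _ hH v hv => isDeRhamFramed_of_localClause (hH v hv))
    fun K _ _ _ => by
      obtain ⟨⟨Rec⟩, hall⟩ := hL K
      exact ⟨Rec, fun n hn hcpt => (hall Rec n hn hcpt).2⟩

/-- **F4 ON-PATH LEMMA for the rung**: `Langlands → FontaineLaffaillePotentialAutomorphyCM`. -/
@[aesop safe apply]
theorem FontaineLaffaillePotentialAutomorphyCM_of_Langlands (hL : _root_.Langlands) :
    FontaineLaffaillePotentialAutomorphyCM :=
  potAutCM_of_langlands 2 hL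

/-- `E → PotAutCM θ` (clause (B) of E for its own `Rec`). -/
theorem potAutCM_of_top (θ : ℕ)
    (hE : Summit.Langlands.Langlands.Theses.OrdinaryPrimeTransport.ReciprocityUpToIrreducibility) :
    PotAutCM θ :=
  potAutCMOn_of_galoisToAutomorphic _ (fun _ _ _ _ _ _ _ hH v hv => isDeRhamFramed_of_localClause (hH v hv))
    fun K _ _ _ => by
      obtain ⟨Rec, hall⟩ := hE K
      exact ⟨Rec, fun n hn hcpt => (hall n hn hcpt).2⟩

/-- `E → rung`. -/
theorem FontaineLaffaillePotentialAutomorphyCM_of_top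
    (hE : Summit.Langlands.Langlands.Theses.OrdinaryPrimeTransport.ReciprocityUpToIrreducibility) :
    FontaineLaffaillePotentialAutomorphyCM :=
  potAutCM_of_top 2 hE

/-! ## 5. The sector, its merge target and the off-sector complement -/

/-- **The regular big-image CM sector of clause (B)**: `F` is CM, `n ≥ 2`, `ρ` lies in cell θ = 3 at every
`v ∣ ℓ` (de Rham, regular labelled Hodge–Tate weights) and has a residual representation with the four residual
hypotheses. -/
def InRegularCMSector (F : Type) [Field F] [NumberField F] (ℓ : ℕ) [Fact ℓ.Prime] {n : ℕ}
    (ρ : FramedGaloisRep F (PadicAlgCl ℓ) n) : Prop :=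
  NumberField.IsCMField F ∧ 2 ≤ n ∧ CellHyp 3 F ℓ n ρ ∧
    ∃ τ : absoluteGaloisGroup F →* GL (Fin n) (padicAlgClResidueField ℓ), ResidualHyp F ℓ ρ τ

/-- **Merge target**: clause (B) of E VERBATIM (cuspidal, L-algebraic, `Corresponds Rec ι π ρ`) for EVERY
reciprocity datum `Rec`, on the regular big-image CM sector. -/
def SectorGaloisToAutomorphic : Prop :=
  ∀ (F : Type) [Field F] [NumberField F] (Rec : ReciprocityData F) (n : ℕ), 0 < n →
    ∀ (hcpt : isCompact_glFiniteIntegralLevel n F) (ℓ : ℕ) [Fact ℓ.Prime] (ι : PadicAlgCl ℓ ≃+* ℂ)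
      (ρ : FramedGaloisRep F (PadicAlgCl ℓ) n),
      ρ.toGaloisRep.IsIrreducible → IsGeometricFramed Rec ρ → InRegularCMSector F ℓ ρ →
        ∃ π : CuspidalAutomorphicRepData n F hcpt, π.1.IsLAlgebraic ∧ Corresponds Rec ι π.1 ρ

/-- **The off-sector complement**: E with clause (A) entire and clause (B) restricted to `ρ` NOT in the regular
big-image CM sector (irregular weights, residually small image, non-CM fields, `n = 1`). -/
def OffSectorReciprocity : Prop :=
  ∀ (F : Type) [Field F] [NumberField F], ∃ Rec : ReciprocityData F, ∀ n : ℕ, 0 < n →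
    ∀ hcpt : isCompact_glFiniteIntegralLevel n F,
      (∀ π : CuspidalAutomorphicRepData n F hcpt, π.1.IsLAlgebraic →
        ∀ (ℓ : ℕ) [Fact ℓ.Prime] (ι : PadicAlgCl ℓ ≃+* ℂ),
          ∃ ρ : FramedGaloisRep F (PadicAlgCl ℓ) n, IsGeometricFramed Rec ρ ∧ Corresponds Rec ι π.1 ρ) ∧
      (∀ (ℓ : ℕ) [Fact ℓ.Prime] (ι : PadicAlgCl ℓ ≃+* ℂ) (ρ : FramedGaloisRep F (PadicAlgCl ℓ) n),
        ρ.toGaloisRep.IsIrreducible → IsGeometricFramed Rec ρ → ¬ InRegularCMSector F ℓ ρ →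
          ∃ π : CuspidalAutomorphicRepData n F hcpt, π.1.IsLAlgebraic ∧ Corresponds Rec ι π.1 ρ)

/-- **The cells above the rung** (gap node): the family on the regular `r` OUTSIDE cell θ = 2 at some `v ∣ ℓ`
(`ℓ` ramified in `K`, weights beyond the Fontaine–Laffaille range, non-crystalline / potentially semistable
non-ordinary types) — the potentially-diagonalizable and general de Rham regular cells. -/
def HigherRungs : Prop :=
  PotAutCMOn fun K _ _ ℓ _ n r => CellHyp 3 K ℓ n r ∧ ¬ CellHyp 2 K ℓ n r

/-- Rung + the cells above it = the family on the whole regular sector θ = 3 (sorry-free glue). [folklore] -/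
theorem family_top_of (hr : FontaineLaffaillePotentialAutomorphyCM) (hh : HigherRungs) : PotAutCM 3 := by
  intro K _ _ hK n hn ℓ _ ι r τ hirr hur hH hres
  by_cases h2 : CellHyp 2 K ℓ n r
  · exact hr K hK n hn ℓ ι r τ hirr hur h2 hres
  · exact hh K hK n hn ℓ ι r τ hirr hur ⟨hH, h2⟩ hres

/-- **Sector-merge step** (gap node): from POTENTIAL weak automorphy on the whole regular big-image CM sector to
clause (B) of E verbatim on that sector (descent of automorphy along the Galois CM extension `K'/K` — soluble
(ACC+ Prop. 6.5.13) and NON-soluble —, cuspidality and L-algebraicity over `K`, and local–global compatibility at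
every finite place against the pinned data), for every reciprocity datum `Rec`. -/
def SectorMergeStep : Prop :=
  PotAutCM 3 → SectorGaloisToAutomorphic

/-! ## 6. The four registered stubs (one per obligation node) -/

/-- **THE RUNG** (open; Matsumoto 2023 problem (*) in the Fontaine–Laffaille range).  Located stop: Dwork/Fermat
witnesses have consecutive weights (Griffiths transversality); non-ordinary change of weight without conjugate
self-duality is not in print (ACC+ Thm. 6.1.1 is fixed-weight; BLGGT §4.3 / Matsumoto Thm. 5.25 need polarisation
or reach only `r_ι(π) ⊗ r`). -/
theorem stub_rung : FontaineLaffaillePotentialAutomorphyCM := by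
  sorry

/-- **The higher rungs** (potentially diagonalizable; arbitrary de Rham regular type; `ℓ` ramified in `K`). -/
theorem stub_higherRungs : HigherRungs := by
  sorry

/-- Sector merge: from potential weak automorphy on the regular big-image CM sector to clause (B) of E verbatim
on the sector, for every `Rec` (descent along `K'/K`; strong multiplicity one; local–global compatibility at every
finite place against the pinned data, Varma 2024 / AHTW 2026 up to the monodromy operator). -/
theorem stub_sectorMerge : SectorMergeStep := by
  sorry

/-- The honest complement: E off the regular big-image CM sector. -/
theorem stub_offSector : OffSectorReciprocity := by
  sorry

/-! ## 7. Composition (no sorry below this line) -/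

/-- **THE SKELETON THEOREM** — the item's decl BY NAME (the `OrdinaryPrimeTransport` copy of the decl, `Iff.rfl`-equal to
the primary `IrreducibilityBySelfDuality` decl), whose only `sorry`s are the four registered stubs `stub_rung`,
`stub_higherRungs`, `stub_sectorMerge`, `stub_offSector`.  On the sector `InRegularCMSector` clause (B) comes from the
ladder `stub_rung → stub_higherRungs → PotAutCM 3` (`family_top_of`, by cases on the FL cell) merged by `stub_sectorMerge`;
off the sector, and for clause (A) everywhere, from `stub_offSector`. -/
theorem reciprocityUpToIrreducibility_of_stubs :
    Summit.Langlands.Langlands.Theses.OrdinaryPrimeTransport.ReciprocityUpToIrreducibility := by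
  intro F _ _
  obtain ⟨Rec, hall⟩ := stub_offSector F
  refine ⟨Rec, fun n hn hcpt => ⟨(hall n hn hcpt).1, ?_⟩⟩
  intro ℓ _ ι ρ hirr hgeo
  by_cases hsec : InRegularCMSector F ℓ ρ
  · exact stub_sectorMerge (family_top_of stub_rung stub_higherRungs) F Rec n hn hcpt ℓ ι ρ hirr hgeo hsec
  · exact (hall n hn hcpt).2 ℓ ι ρ hirr hgeo hsec

/-- The ladder's top, a REDUCIBLE alias of the crux decl (so that exactly one THEOREM of this file — the skeleton
theorem `reciprocityUpToIrreducibility_of_stubs` above — has the crux decl itself as its conclusion head, as the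
`#h21_check_skeleton` audit requires; `LadderTop` is the same proposition by `Iff.rfl`). -/
abbrev LadderTop : Prop :=
  Summit.Langlands.Langlands.Theses.OrdinaryPrimeTransport.ReciprocityUpToIrreducibility

example : LadderTop ↔ Summit.Langlands.Langlands.Theses.OrdinaryPrimeTransport.ReciprocityUpToIrreducibility :=
  Iff.rfl

/-- **COMPOSITION IN HYPOTHESIS FORM** — the crux (through its reducible alias `LadderTop`) from the four stub
STATEMENTS, with no `sorry` anywhere in this theorem or its dependencies: the typed ladder
`Rung θ₁ → Gap → Merge → OffSector → C`. -/
theorem ReciprocityUpToIrreducibility_of :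
    FontaineLaffaillePotentialAutomorphyCM → HigherRungs → SectorMergeStep → OffSectorReciprocity → LadderTop := by
  intro hr hh hmerge hoff F _ _
  obtain ⟨Rec, hall⟩ := hoff F
  refine ⟨Rec, fun n hn hcpt => ⟨(hall n hn hcpt).1, ?_⟩⟩
  intro ℓ _ ι ρ hirr hgeo
  by_cases hsec : InRegularCMSector F ℓ ρ
  · exact hmerge (family_top_of hr hh) F Rec n hn hcpt ℓ ι ρ hirr hgeo hsec
  · exact (hall n hn hcpt).2 ℓ ι ρ hirr hgeo hsec

#print axioms ReciprocityUpToIrreducibility_of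

end Summit.Langlands.Langlands.Cruxes.ReciprocityUpToIrreducibility.FontaineLaffaillePotentialAutomorphyCM

end
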